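import Summits.QuantumFields.BalabanUV.Beta.GAN24.PerturbedPropagatorVolumeLimit
import Summits.QuantumFields.BalabanUV.Beta.GAN24.BackgroundVolumeLimit

/-!
# `BalabanUV.Beta.GAN24.InsertionChainVolumeLimit` — binder row G-an2-4 ∕ (CONV-C), route R7 «TWO CURRENCIES», PART 156: THE INPUT TRIPLE ((UD), (SR), EL₂) IS CLOSED UNDER PRODUCTS;
# THE n-TH INSERTION CHAIN `X^{(n)}_k = L^{dk}Q_k((𝒢P)^n𝒢)Q_kᴴ` HAS (UD)+(SR) VOLUME-FREE FOR EVERY `n`, AND THE SECOND CHAIN HAS EL₂ MODULO THE BACKGROUND's POINTWISE LIMIT.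
# The second u-derivative of the effective form at `U = 1`, `Σ̈_k = 2(c_k⁻¹ċ_kc_k⁻¹ċ_kc_k⁻¹ − c_k⁻¹(c̈_k∕2)c_k⁻¹)` (PART 121; `ċ_k = X^{(1)}_k`, `c̈_k∕2 = X^{(2)}_k`), is the order at which the
# one-loop vacuum-polarization shape lives; its `ℤ^d` END (PART 157) needs exactly two things beyond PARTs 143 ∕ 147: a REUSABLE product step for the triple ((UD), (SR), EL₂) on volume
# families (§1 — PART 130's `entryDecay_mul` ∕ `twoLevelDecayRate_mul` with PART 127's letter, PART 142's `tendsto_mul_entry_pair`), and the inputs of the chains `X^{(n)}` (§2 — PART 126's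
# `decayStations_firstOrderInsertion_QB` at every `n`, generalising PART 147's `n = 1`; §3 — EL₂ of `X^{(2)}`: the fine kernel `𝒢P𝒢P𝒢 = 𝒢·(P𝒢)(P𝒢)` by PART 151's stencil lemmas and PART
# 144's pair products, lifted by PART 151's middle-free unit-lattice stencil) (unit b2b-balaban-gan24-p3, gen 55; v1)

NOT IN PRINT; OUR PROOF ([folklore] bookkeeping BY NAME over PART 130 (`entryDecay_mul_tower`, `twoLevelDecayRate_mul`), PART 127 (`sum_exp_distK_le`, `distK_nonneg ∕ _triangle`), PART 142
(`tendsto_mul_entry_pair`, `norm_le_exp_window_of_entryDecay`), PART 143 (`norm_le_of_entryDecay`), PART 126 (`decayStations_firstOrderInsertion_QB`), PART 124 (`exists_admissible_rate`), PART 128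
(`entryDecay_of_le_rate`), PART 151 (`tendsto_Pmodel_mul_pair`, `norm_Pmodel_mul_apply_le`, `tendsto_avgTow_pair_of_fine`), PART 149 (`tendsto_Pmodel_pair_of_tendsto`), PART 146
(`tendsto_calGlev_pair`, `norm_mul_apply_le_of_window`), PART 145 (`exists_fineWindowDecay_calGlev`), PART 144 (`tendsto_mul_pair'`); [Balaban1987RG1] (1.21)–(1.22) p. 264 LOCATE the shapes).
HONEST FRAMING (cell contract, verbatim): «discharging `BetaPertH` makes Bałaban's UV stability UNCONDITIONAL — a real constructive-QFT result; it is NOT the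
continuum limit and NOT the Clay problem.»  HONEST DEPENDENCY (verbatim): «continuum YM on T⁴ ⇐ BetaPertH ∧ nine spine estimates (0/9 proved); BetaPertH ⇐
(D1) ∧ (D4) ∧ CAP+tail; G-an2-4 gates asym, D1 and NE2/3/4.»

WHAT THIS FILE PROVES (0 sorry, 0 `def`; `e = unitIdx⁻¹`; «INPUTS of a tower family `X_t k`» = (UD) `EntryDecay distK (X_t k) B κ` ∀ t k, (SR) `TwoLevelDecayRate distK (X_t ·) B′ κ θ` ∀ t,
EL₂ `∀ k μ ν z z′, ∃ s, X_t k (e(ẑ_t,μ)) (e(ẑ′_t,ν)) → s`):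
* §1 **`mul_inputs`** (`d ≥ 2`, `side t → ∞`, `κ > 0`): INPUTS of `X` at `(B_X, B_X′, κ, θ)` and of `Y` at `(B_Y, B_Y′, κ, θ)` ⟹ INPUTS of `X·Y` at `(B_XB_Y dS, (B_X′B_Y + B_XB_Y′) dS, κ∕2, θ)`;
  `inputs_of_le_rate` (INPUTS at `κ` ⟹ INPUTS at any `0 < κ′ ≤ κ`).
* §2 **`insertionChain_decay_inputs`** (`L ≥ 2`, `d ≥ 1`, every `n`): `∃ κ > 0, B, B′ ≥ 0` from `(d, L, a, α, β, n)` with (UD)+(SR) (`θ = √(L⁻¹)`) of `X^{(n)}` for EVERY torus and EVERY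
  Lipschitz background `(α, β)` — PART 147's `insertion_decay_inputs` at general `n`.
* §3 `chain2_eq` (`((𝒢P)^2)𝒢 = 𝒢·((P𝒢)(P𝒢))`), **`tendsto_chain2_fine_pair`** (`d ≥ 3`, even cubic volumes: EL₂ of `𝒢·((P𝒢)(P𝒢))` at fine integer pairs modulo EL₁ of `V_t`),
  **`tendsto_chain2_pair`** (EL₂ of `X^{(2)}` at unit integer pairs), **`tendsto_chain1_pair`** (the same for `X^{(1)}`, PART 146 re-read through `avgIns_eq`).
WHAT IT DOES NOT DO: the END for `Σ̈_k` (PART 157); chains `n ≥ 3` at the EL₂ level (same proof, follower); `U ≠ 1`; `d ≤ 2` ∕ odd volumes.  SUPPLIER work; NEVER «G-an2-4 closed»;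
NOT (CONV-C), NOT D1, NOT `BetaPertH`, NOT continuum, NOT Clay.  Records: `HOME/b2b-balaban-gan24-p3/gen55/README.md`.
-/

noncomputable section

open scoped BigOperators ComplexConjugate Matrix Matrix.Norms.L2Operator
open Filter Topology

namespace Summit.QuantumFields.BalabanUV.Beta.GAN24.InsertionChainVolumeLimit

open Literature.MathematicalPhysics.QuantumFieldTheory.Balaban1983to89
open Literature.MathematicalPhysics.QuantumFieldTheory.Balaban1983to89.B5Prop11Plancherel (Tor fine Cst Cst_nonneg)
open Literature.MathematicalPhysics.QuantumFieldTheory.Balaban1983to89.B5G183RateUnitTower (lev)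
open Literature.MathematicalPhysics.QuantumFieldTheory.Balaban1983to89.B12Sec2to5 (l1)
open Literature.MathematicalPhysics.QuantumFieldTheory.Balaban1983to89.Beta (Site windowMap)
open Literature.MathematicalPhysics.QuantumFieldTheory.Balaban1983to89.Beta.FreeLegDictionary (cubic)
open Literature.MathematicalPhysics.QuantumFieldTheory.Balaban1983to89.Beta.BlockKernelVolumeSockets (evenPeriod tendsto_evenPeriod)
open Literature.MathematicalPhysics.QuantumFieldTheory.Balaban1983to89.Beta.VectorTails (castT)
open Summit.QuantumFields.BalabanUV.T4Continuum
open Summit.QuantumFields.BalabanUV.T4Continuum.CovariantAveragingTower (avgTow)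
open Summit.QuantumFields.BalabanUV.T4Continuum.BalabanAveragedTowerUnit (idx QBlev calGlev one_le_lev')
open Summit.QuantumFields.BalabanUV.T4Continuum.BalabanAveragedCoerciveTower (unitIdx)
open Summit.QuantumFields.BalabanUV.T4Continuum.KingPairingPlantedLaw (calDalev calDalev_inv CJ)
open Summit.QuantumFields.BalabanUV.T4Continuum.CTConjugatedHbd (G2)
open Summit.QuantumFields.BalabanUV.T4Continuum.FirstOrderBackgroundModel (LipschitzBackground Pmodel C2model)
open Summit.QuantumFields.BalabanUV.T4Continuum.CTKingTowerWeights (distK)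
open Summit.QuantumFields.BalabanUV.T4Continuum.CTConjDefectDischarge (max_JA_lt_gamD)
open Summit.QuantumFields.BalabanUV.T4Continuum.DirichletRegionTower (gamD)
open Summit.QuantumFields.BalabanUV.T4Continuum.CTVectorPropagator (JA)
open Summit.QuantumFields.BalabanUV.T4Continuum.DecayRateInterpolation (EntryDecay DecayRate TwoLevelDecayRate)
open Summit.QuantumFields.BalabanUV.Beta.GAN24.DiagramDecayAlgebra (entryDecay_add entryDecay_mul_tower twoLevelDecayRate_mul twoLevelDecayRate_of_le_rate)
open Summit.QuantumFields.BalabanUV.Beta.GAN24.UnitLatticeDecayAlgebra (distK_nonneg distK_triangle sum_exp_distK_le)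
open Summit.QuantumFields.BalabanUV.Beta.GAN24.EffectiveFormDecay (entryDecay_of_le_rate)
open Summit.QuantumFields.BalabanUV.Beta.GAN24.InsertionChainDecay (exists_admissible_rate)
open Summit.QuantumFields.BalabanUV.Beta.GAN24.InsertionChainDecayBalaban (decayStations_firstOrderInsertion_QB)
open Summit.QuantumFields.BalabanUV.Beta.GAN24.DiagramVolumeLimitPairs (tendsto_mul_entry_pair norm_le_exp_window_of_entryDecay l1_windowMap_neg)
open Summit.QuantumFields.BalabanUV.Beta.GAN24.DiagramVolumeLimitSandwich (norm_le_of_entryDecay)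
open Summit.QuantumFields.BalabanUV.Beta.GAN24.VolumeLimitPairsFibre (tendsto_mul_pair')
open Summit.QuantumFields.BalabanUV.Beta.GAN24.FinePropagatorDecay (exists_fineWindowDecay_calGlev)
open Summit.QuantumFields.BalabanUV.Beta.GAN24.FineInsertionVolumeLimit (norm_mul_apply_le_of_window tendsto_calGlev_pair tendsto_GPG_pair)
open Summit.QuantumFields.BalabanUV.Beta.GAN24.EffectiveFormInsertionVolumeLimit (norm_Pmodel_apply_le avgIns_eq)
open Summit.QuantumFields.BalabanUV.Beta.GAN24.BackgroundVolumeLimit (tendsto_Pmodel_pair_of_tendsto)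
open Summit.QuantumFields.BalabanUV.Beta.GAN24.PerturbedPropagatorVolumeLimit (tendsto_Pmodel_mul_pair norm_Pmodel_mul_apply_le tendsto_avgTow_pair_of_fine)

variable {d : ℕ} (L : ℕ) [NeZero L]

/-! ## §1 The input triple is closed under products -/

section Products

variable {side : ℕ → ℕ} [∀ t, NeZero (side t)]

/-- **`mul_inputs` — THE TRIPLE ((UD), (SR), EL₂) IS CLOSED UNDER PRODUCTS** [folklore] (`d ≥ 2`, `side t → ∞`, `κ > 0`, `θ ≥ 0`): for volume-indexed towers `X_t, Y_t` on the unit index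
sets of the cubic tori with (UD) `(B_X, κ)`, `(B_Y, κ)`, (SR) `(B_X′, κ, θ)`, `(B_Y′, κ, θ)` (all `t`, constants `≥ 0` free of `t, k`) and EL₂, the product tower `X_t k·Y_t k` has (UD)+(SR) at
rate `κ∕2` with constants `B, B′` depending on `(d, κ, B_X, B_X′, B_Y, B_Y′)` only (`B ≥ 0`; `B′ ≥ 0` as soon as the input constants are), and EL₂ (PART 130's product rules with PART
127's letter; PART 142's pair Tannery, `Y` decaying). -/
theorem mul_inputs (hd : 2 ≤ d) (hside : Tendsto side atTop atTop)
    {X Y : (t : ℕ) → ℕ → Matrix (idx L (cubic d (side t)) 0) (idx L (cubic d (side t)) 0) ℂ} {BX BX' BY BY' κ θ : ℝ}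
    (hκ : 0 < κ) (hBX : 0 ≤ BX)
    (hXud : ∀ t k, EntryDecay (distK L (cubic d (side t))) (X t k) BX κ) (hXsr : ∀ t, TwoLevelDecayRate (distK L (cubic d (side t))) (X t) BX' κ θ)
    (hYud : ∀ t k, EntryDecay (distK L (cubic d (side t))) (Y t k) BY κ) (hYsr : ∀ t, TwoLevelDecayRate (distK L (cubic d (side t))) (Y t) BY' κ θ)
    (hXel : ∀ k μ ν (z z' : Fin d → ℤ), ∃ s' : ℂ, Tendsto (fun t => X t k ((unitIdx L (cubic d (side t))).symm (castT (cubic d (side t)) z, μ))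
      ((unitIdx L (cubic d (side t))).symm (castT (cubic d (side t)) z', ν))) atTop (𝓝 s'))
    (hYel : ∀ k μ ν (z z' : Fin d → ℤ), ∃ s' : ℂ, Tendsto (fun t => Y t k ((unitIdx L (cubic d (side t))).symm (castT (cubic d (side t)) z, μ))
      ((unitIdx L (cubic d (side t))).symm (castT (cubic d (side t)) z', ν))) atTop (𝓝 s')) :
    ∃ S : ℝ, 0 ≤ S ∧
      (∀ t k, EntryDecay (distK L (cubic d (side t))) (X t k * Y t k) (BX * BY * (d * S)) (κ / 2)) ∧
      (∀ t, TwoLevelDecayRate (distK L (cubic d (side t))) (fun k => X t k * Y t k) ((BX' * BY + BX * BY') * (d * S)) (κ / 2) θ) ∧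
      (∀ k μ ν (z z' : Fin d → ℤ), ∃ s' : ℂ, Tendsto (fun t => (X t k * Y t k) ((unitIdx L (cubic d (side t))).symm (castT (cubic d (side t)) z, μ))
        ((unitIdx L (cubic d (side t))).symm (castT (cubic d (side t)) z', ν))) atTop (𝓝 s')) := by
  have hd0 : (0 : ℝ) < d := by exact_mod_cast lt_of_lt_of_le zero_lt_two hd
  obtain ⟨S, hS0, hS⟩ := sum_exp_distK_le hd (half_pos hκ)
  refine ⟨S, hS0, fun t k => ?_, fun t => ?_, fun k μ ν z z' => ?_⟩
  · exact entryDecay_mul_tower (distK_nonneg L (cubic d (side t))) (distK_triangle L (cubic d (side t))) hκ.le (fun x => hS L (cubic d (side t)) x) (hXud t) (hYud t) k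
  · exact twoLevelDecayRate_mul (distK_nonneg L (cubic d (side t))) (distK_triangle L (cubic d (side t))) hκ.le (fun x => hS L (cubic d (side t)) x)
      (hXud t) (hYud t) (hXsr t) (hYsr t)
  · exact tendsto_mul_entry_pair L hside (X := fun t => X t k) (Y := fun t => Y t k)
      (fun t x μ' w l => norm_le_of_entryDecay L (side t) hκ.le hBX (hXud t k) _ _)
      (fun t w l y ν' => norm_le_exp_window_of_entryDecay L (side t) hκ.le (hYud t k) w l y ν') (div_pos hκ hd0) (hXel k) (hYel k) μ ν z z'

omit [NeZero L] [∀ t, NeZero (side t)] in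
/-- (UD)+(SR) at rate `κ` ⟹ at any rate `κ′ ≤ κ` (PART 128 ∕ 130 monotonicity, packaged for volume families). [folklore] -/
theorem inputs_of_le_rate {X : (t : ℕ) → ℕ → Matrix (idx L (cubic d (side t)) 0) (idx L (cubic d (side t)) 0) ℂ} {B B' κ κ' θ : ℝ}
    (hB : 0 ≤ B) (hB' : 0 ≤ B') (hθ : 0 ≤ θ) (hκ' : κ' ≤ κ)
    (hud : ∀ t k, EntryDecay (distK L (cubic d (side t))) (X t k) B κ) (hsr : ∀ t, TwoLevelDecayRate (distK L (cubic d (side t))) (X t) B' κ θ) :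
    (∀ t k, EntryDecay (distK L (cubic d (side t))) (X t k) B κ') ∧ (∀ t, TwoLevelDecayRate (distK L (cubic d (side t))) (X t) B' κ' θ) :=
  ⟨fun t k => entryDecay_of_le_rate (distK_nonneg L (cubic d (side t))) (hud t k) hB hκ',
    fun t => twoLevelDecayRate_of_le_rate (distK_nonneg L (cubic d (side t))) (hsr t) hB' hθ hκ'⟩

end Products

/-! ## §2 (UD)+(SR) of the `n`-th insertion chain, volume-free, every Lipschitz background -/

section Chains

variable (a : ℝ) (ha : 0 < a)

/-- **`insertionChain_decay_inputs` — (UD)+(SR) OF `X^{(n)}_k = L^{dk}Q_k((Δ_a⁻¹P)^nΔ_a⁻¹)Q_kᴴ`, VOLUME-FREE, EVERY `n`** (`L ≥ 2`, `d ≥ 1`): `∃ κ > 0, B, B′ ≥ 0` depending on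
`(d, L, a, α, β, n)` only such that for EVERY torus `M` and EVERY background with `LipschitzBackground L M V α β`: (UD) `EntryDecay distK (X^{(n)}_k) B κ` ∀ `k` and (SR)
`TwoLevelDecayRate distK X^{(n)} B′ κ (√(L⁻¹))` — PART 126's `decayStations_firstOrderInsertion_QB` at an admissible rate, (UD) = limit decay + the `DecayRate` clause at half the rate
(PART 147's `insertion_decay_inputs` is `n = 1`). -/
theorem insertionChain_decay_inputs (hL : 2 ≤ L) (hd : 1 ≤ d) (α β : ℝ) (n : ℕ) :
    ∃ κ B B' : ℝ, 0 < κ ∧ 0 ≤ B ∧ 0 ≤ B' ∧ ∀ (M : Fin d → ℕ) [∀ μ, NeZero (M μ)] (V : (k : ℕ) → Fin d → (idx L M k → ℂ)), LipschitzBackground L M V α β →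
      (∀ k, EntryDecay (distK L M) (avgTow (QBlev L M) ((L : ℝ) ^ d) (fun k => ((calDalev L M a ha k)⁻¹ * Pmodel L M V k) ^ n * (calDalev L M a ha k)⁻¹) k) B κ) ∧
      TwoLevelDecayRate (distK L M) (avgTow (QBlev L M) ((L : ℝ) ^ d) (fun k => ((calDalev L M a ha k)⁻¹ * Pmodel L M V k) ^ n * (calDalev L M a ha k)⁻¹)) B' κ (Real.sqrt ((L : ℝ)⁻¹)) := by
  obtain ⟨κ, hκ0, -, hγ', hδ', hJA⟩ := exists_admissible_rate d a
  have hJγ : max (JA d a 1 κ 1) 0 < gamD d a := max_JA_lt_gamD a hJA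
  set Bl : ℝ := (gamD d a - max (JA d a 1 κ 1) 0)⁻¹ * (d * (α * G2 d a (max (JA d a 1 κ 1) 0) (gamD d a - max (JA d a 1 κ 1) 0) κ)) ^ n * Real.exp (κ * 4) with hBl
  set R : ℝ := Real.sqrt (2 * ((gamD d a - max (JA d a 1 κ 1) 0)⁻¹
      * (d * (α * G2 d a (max (JA d a 1 κ 1) 0) (gamD d a - max (JA d a 1 κ 1) 0) κ)) ^ n * Real.exp (κ * 4))
    * (((((n : ℝ) + 1) * (d * (α + β) * Cst d a) ^ n * CJ d a + (n : ℝ) * (d * (α + β) * Cst d a) ^ (n - 1) * C2model d L a α β)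
        + (d * (α + β) * Cst d a) ^ n * (2 * d * Cst d a + 2 * (d * L * Cst d a))) / (1 - (L : ℝ)⁻¹))) with hR
  set R' : ℝ := Real.sqrt (2 * ((gamD d a - max (JA d a 1 κ 1) 0)⁻¹
      * (d * (α * G2 d a (max (JA d a 1 κ 1) 0) (gamD d a - max (JA d a 1 κ 1) 0) κ)) ^ n * Real.exp (κ * 4))
    * (2 * ((((n : ℝ) + 1) * (d * (α + β) * Cst d a) ^ n * CJ d a + (n : ℝ) * (d * (α + β) * Cst d a) ^ (n - 1) * C2model d L a α β)
        + (d * (α + β) * Cst d a) ^ n * (2 * d * Cst d a + 2 * (d * L * Cst d a))) / (1 - (L : ℝ)⁻¹))) with hR'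
  have hθ0 : 0 ≤ Real.sqrt ((L : ℝ)⁻¹) := Real.sqrt_nonneg _
  have hθ1 : Real.sqrt ((L : ℝ)⁻¹) ≤ 1 := by
    rw [Real.sqrt_le_one]; exact inv_le_one_of_one_le₀ (by exact_mod_cast le_trans one_le_two hL)
  refine ⟨κ / 2, max Bl 0 + R, R', half_pos hκ0, add_nonneg (le_max_right _ _) (Real.sqrt_nonneg _), Real.sqrt_nonneg _, fun M _ V hV => ?_⟩
  obtain ⟨clim, -, hlim, hrate, hstep⟩ := decayStations_firstOrderInsertion_QB L M a ha hL hd hV one_pos hκ0.le hγ' hδ' hJA n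
  refine ⟨fun k => ?_, hstep⟩
  have hlim' : EntryDecay (distK L M) clim (max Bl 0) κ := fun x y => (hlim x y).trans (mul_le_mul_of_nonneg_right (le_max_left _ _) (Real.exp_pos _).le)
  have h1 : EntryDecay (distK L M) clim (max Bl 0) (κ / 2) := entryDecay_of_le_rate (distK_nonneg L M) hlim' (le_max_right _ _) (half_le_self hκ0.le)
  have h2 : EntryDecay (distK L M) (avgTow (QBlev L M) ((L : ℝ) ^ d) (fun k => ((calDalev L M a ha k)⁻¹ * Pmodel L M V k) ^ n * (calDalev L M a ha k)⁻¹) k - clim) R (κ / 2) := by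
    intro x y
    exact (hrate k x y).trans (mul_le_mul_of_nonneg_right (mul_le_of_le_one_right (Real.sqrt_nonneg _) (pow_le_one₀ hθ0 hθ1)) (Real.exp_pos _).le)
  have e : avgTow (QBlev L M) ((L : ℝ) ^ d) (fun k => ((calDalev L M a ha k)⁻¹ * Pmodel L M V k) ^ n * (calDalev L M a ha k)⁻¹) k
      = clim + (avgTow (QBlev L M) ((L : ℝ) ^ d) (fun k => ((calDalev L M a ha k)⁻¹ * Pmodel L M V k) ^ n * (calDalev L M a ha k)⁻¹) k - clim) := by abel
  rw [e]
  exact entryDecay_add h1 h2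

end Chains

/-! ## §3 EL₂ of the second insertion chain, modulo the background's pointwise limit -/

section ChainLimits

variable (a : ℝ) (ha : 0 < a)

/-- `((𝒢P)^2)𝒢 = 𝒢·((P𝒢)(P𝒢))` at every level (`Δ_a⁻¹ = 𝒢`, associativity). [folklore] -/
theorem chain2_eq (M : Fin d → ℕ) [∀ μ, NeZero (M μ)] (k : ℕ) (P : Matrix (idx L M k) (idx L M k) ℂ) :
    ((calDalev L M a ha k)⁻¹ * P) ^ 2 * (calDalev L M a ha k)⁻¹ = calGlev L M a ha k * ((P * calGlev L M a ha k) * (P * calGlev L M a ha k)) := by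
  rw [calDalev_inv, pow_two]
  simp only [Matrix.mul_assoc]

/-- **`tendsto_chain2_fine_pair` — EL₂ OF THE FINE KERNEL `(𝒢P)^2𝒢 = 𝒢P𝒢P𝒢` AT FINE INTEGER PAIRS, MODULO EL₁ OF THE BACKGROUND** [our proof] (`d ≥ 3`, `a > 0`, level `k`, even cubic
volumes; Lipschitz backgrounds `(α, β)` uniform in the volume): `P𝒢` has EL₂ (PART 151 with PART 146's EL₂ of `𝒢`) and fine window decay (PART 151), so `(P𝒢)(P𝒢)` has EL₂ (PART 144, left
factor decaying) and a volume-free bound (PART 146), hence `𝒢·((P𝒢)(P𝒢))` has EL₂ (PART 144, `𝒢` decaying on the left). [cite: Balaban1987RG1, p.264 (after (1.21): the `T ↗ ℤ^d` limit)] -/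
theorem tendsto_chain2_fine_pair (hd : 3 ≤ d) (k : ℕ) {α β : ℝ}
    {V : (t : ℕ) → (k : ℕ) → Fin d → (idx L (cubic d (evenPeriod t)) k → ℂ)} (hV : ∀ t, LipschitzBackground L (cubic d (evenPeriod t)) (V t) α β)
    (hV1 : ∀ (μ f : Fin d) (z : Fin d → ℤ), ∃ s : ℂ, Tendsto (fun t => V t k μ (castT (cubic d (lev L k * evenPeriod t)) z, f)) atTop (𝓝 s))
    (f g : Fin d) (z z' : Fin d → ℤ) :
    ∃ s : ℂ, Tendsto (fun t => (calGlev L (cubic d (evenPeriod t)) a ha k * ((Pmodel L (cubic d (evenPeriod t)) (V t) k * calGlev L (cubic d (evenPeriod t)) a ha k)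
        * (Pmodel L (cubic d (evenPeriod t)) (V t) k * calGlev L (cubic d (evenPeriod t)) a ha k)))
      (castT (cubic d (lev L k * evenPeriod t)) z, f) (castT (cubic d (lev L k * evenPeriod t)) z', g)) atTop (𝓝 s) := by
  have hd1 : 1 ≤ d := le_trans (by norm_num) hd
  have hd0 : (0 : ℝ) < d := by exact_mod_cast lt_of_lt_of_le zero_lt_one hd1
  have hn : (0 : ℝ) < lev L k := by exact_mod_cast Nat.pos_of_ne_zero (NeZero.ne (lev L k))
  have hside : Tendsto (fun t => lev L k * evenPeriod t) atTop atTop :=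
    Filter.Tendsto.const_mul_atTop' (Nat.pos_of_ne_zero (NeZero.ne (lev L k))) tendsto_evenPeriod |>.congr fun t => by ring
  have hα : 0 ≤ α := (hV 0).nonneg.1
  obtain ⟨κ, C, hκ, hC, hdec⟩ := exists_fineWindowDecay_calGlev L a ha
  have hδ : 0 < κ / (d * lev L k) := div_pos hκ (mul_pos hd0 hn)
  have hGr : ∀ t (w : Site d (lev L k * evenPeriod t)) (g : Fin d) (y : Site d (lev L k * evenPeriod t)) (h : Fin d),
      ‖calGlev L (cubic d (evenPeriod t)) a ha k (w, g) (y, h)‖ ≤ C * Real.exp (-(κ / (d * lev L k)) * l1 (windowMap d (lev L k * evenPeriod t) (w - y))) :=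
    fun t w g y h => hdec (evenPeriod t) k w y g h
  have hGl : ∀ t (x : Site d (lev L k * evenPeriod t)) (f : Fin d) (w : Site d (lev L k * evenPeriod t)) (g : Fin d),
      ‖calGlev L (cubic d (evenPeriod t)) a ha k (x, f) (w, g)‖ ≤ C * Real.exp (-(κ / (d * lev L k)) * l1 (windowMap d (lev L k * evenPeriod t) (w - x))) := by
    intro t x f w g
    have h := hdec (evenPeriod t) k x w f g
    rwa [show x - w = -(w - x) from (neg_sub w x).symm, l1_windowMap_neg] at h
  have hGel := fun f g w w' => tendsto_calGlev_pair L a ha hd k f g w w'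
  -- `X_t = P𝒢`: decay from the right site read as decay from the left site, bound, EL₂
  set CX : ℝ := d * (α * lev L k * ((Real.exp (3 * (κ / (d * lev L k))) + 1) * C)) with hCX
  have hCX0 : 0 ≤ CX := by positivity
  have hXdec : ∀ t (w : Site d (lev L k * evenPeriod t)) (g : Fin d) (y : Site d (lev L k * evenPeriod t)) (h : Fin d),
      ‖(Pmodel L (cubic d (evenPeriod t)) (V t) k * calGlev L (cubic d (evenPeriod t)) a ha k) (w, g) (y, h)‖
        ≤ CX * Real.exp (-(κ / (d * lev L k)) * l1 (windowMap d (lev L k * evenPeriod t) (w - y))) :=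
    fun t w g y h => norm_Pmodel_mul_apply_le L (evenPeriod t) (hV t) k hC hδ.le (hGr t) w g y h
  have hXdecl : ∀ t (x : Site d (lev L k * evenPeriod t)) (f : Fin d) (w : Site d (lev L k * evenPeriod t)) (g : Fin d),
      ‖(Pmodel L (cubic d (evenPeriod t)) (V t) k * calGlev L (cubic d (evenPeriod t)) a ha k) (x, f) (w, g)‖
        ≤ CX * Real.exp (-(κ / (d * lev L k)) * l1 (windowMap d (lev L k * evenPeriod t) (w - x))) := by
    intro t x f w g
    have h := hXdec t x f w g
    rwa [show x - w = -(w - x) from (neg_sub w x).symm, l1_windowMap_neg] at h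
  have hXb : ∀ t (w : Site d (lev L k * evenPeriod t)) (g : Fin d) (y : Site d (lev L k * evenPeriod t)) (h : Fin d),
      ‖(Pmodel L (cubic d (evenPeriod t)) (V t) k * calGlev L (cubic d (evenPeriod t)) a ha k) (w, g) (y, h)‖ ≤ CX := by
    intro t w g y h
    refine (hXdec t w g y h).trans ?_
    have : Real.exp (-(κ / (d * lev L k)) * l1 (windowMap d (lev L k * evenPeriod t) (w - y))) ≤ 1 := by
      rw [Real.exp_le_one_iff, neg_mul, neg_nonpos]; exact mul_nonneg hδ.le (Finset.sum_nonneg fun i _ => abs_nonneg _)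
    simpa using mul_le_mul_of_nonneg_left this hCX0
  have hXel := tendsto_Pmodel_mul_pair L (side := evenPeriod) k V hV1 (G := fun t => calGlev L (cubic d (evenPeriod t)) a ha k) hGel
  -- `(P𝒢)(P𝒢)`: EL₂ (left factor decaying) and the volume-free bound
  have hXXel := tendsto_mul_pair' (d := d) (F := Fin d) (side := fun t => lev L k * evenPeriod t) hside
    (X := fun t => Pmodel L (cubic d (evenPeriod t)) (V t) k * calGlev L (cubic d (evenPeriod t)) a ha k)
    (Y := fun t => Pmodel L (cubic d (evenPeriod t)) (V t) k * calGlev L (cubic d (evenPeriod t)) a ha k) hXdecl hδ hXb hXel hXel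
  have hXXb : ∀ t (w : Site d (lev L k * evenPeriod t)) (g : Fin d) (y : Site d (lev L k * evenPeriod t)) (h : Fin d),
      ‖((Pmodel L (cubic d (evenPeriod t)) (V t) k * calGlev L (cubic d (evenPeriod t)) a ha k)
        * (Pmodel L (cubic d (evenPeriod t)) (V t) k * calGlev L (cubic d (evenPeriod t)) a ha k)) (w, g) (y, h)‖
        ≤ CX * CX * (Fintype.card (Fin d) * ∑' y : Fin d → ℤ, Real.exp (-(κ / (d * lev L k)) * l1 y)) :=
    fun t w g y h => norm_mul_apply_le_of_window (lev L k * evenPeriod t) hδ hCX0 hCX0 (hXdecl t) (hXb t) w g y h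
  -- `𝒢·((P𝒢)(P𝒢))`
  exact tendsto_mul_pair' (d := d) (F := Fin d) (side := fun t => lev L k * evenPeriod t) hside
    (X := fun t => calGlev L (cubic d (evenPeriod t)) a ha k)
    (Y := fun t => (Pmodel L (cubic d (evenPeriod t)) (V t) k * calGlev L (cubic d (evenPeriod t)) a ha k)
      * (Pmodel L (cubic d (evenPeriod t)) (V t) k * calGlev L (cubic d (evenPeriod t)) a ha k)) hGl hδ hXXb hGel hXXel f g z z'

/-- **`tendsto_chain2_pair` — EL₂ OF THE SECOND INSERTION CHAIN `X^{(2)}_k` ON THE UNIT LATTICE, MODULO EL₁ OF THE BACKGROUND** [our proof] (`d ≥ 3`, even cubic volumes): PART 151's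
middle-free stencil on `tendsto_chain2_fine_pair`. [cite: Balaban1987RG1, p.264 (after (1.21): the `T ↗ ℤ^d` limit)] -/
theorem tendsto_chain2_pair (hd : 3 ≤ d) (k : ℕ) {α β : ℝ}
    {V : (t : ℕ) → (k : ℕ) → Fin d → (idx L (cubic d (evenPeriod t)) k → ℂ)} (hV : ∀ t, LipschitzBackground L (cubic d (evenPeriod t)) (V t) α β)
    (hV1 : ∀ (μ f : Fin d) (z : Fin d → ℤ), ∃ s : ℂ, Tendsto (fun t => V t k μ (castT (cubic d (lev L k * evenPeriod t)) z, f)) atTop (𝓝 s))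
    (μ ν : Fin d) (z z' : Fin d → ℤ) :
    ∃ s : ℂ, Tendsto (fun t => (avgTow (QBlev L (cubic d (evenPeriod t))) ((L : ℝ) ^ d)
        (fun k' => ((calDalev L (cubic d (evenPeriod t)) a ha k')⁻¹ * Pmodel L (cubic d (evenPeriod t)) (V t) k') ^ 2 * (calDalev L (cubic d (evenPeriod t)) a ha k')⁻¹) k)
      ((unitIdx L (cubic d (evenPeriod t))).symm (castT (cubic d (evenPeriod t)) z, μ)) ((unitIdx L (cubic d (evenPeriod t))).symm (castT (cubic d (evenPeriod t)) z', ν))) atTop (𝓝 s) := by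
  simp only [chain2_eq]
  obtain ⟨s, hs⟩ := tendsto_avgTow_pair_of_fine L k
    (X := fun t k' => calGlev L (cubic d (evenPeriod t)) a ha k' * ((Pmodel L (cubic d (evenPeriod t)) (V t) k' * calGlev L (cubic d (evenPeriod t)) a ha k')
      * (Pmodel L (cubic d (evenPeriod t)) (V t) k' * calGlev L (cubic d (evenPeriod t)) a ha k')))
    (fun f g w w' => tendsto_chain2_fine_pair L a ha hd k hV hV1 f g w w') μ ν z z'
  refine ⟨s, hs.congr fun t => ?_⟩
  simp only [Matrix.reindex_apply, Matrix.submatrix_apply]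

/-- **`tendsto_chain1_pair` — EL₂ OF THE FIRST INSERTION CHAIN `X^{(1)}_k` ON THE UNIT LATTICE, MODULO EL₁ OF THE BACKGROUND** [our proof] (`d ≥ 3`, even cubic volumes): PART 146's
`tendsto_GPG_pair` (EL₂ of `P` from PART 149) through PART 151's stencil, read back through `avgIns_eq`. [cite: Balaban1987RG1, p.264 (after (1.21): the `T ↗ ℤ^d` limit)] -/
theorem tendsto_chain1_pair (hd : 3 ≤ d) (k : ℕ) {α β : ℝ}
    {V : (t : ℕ) → (k : ℕ) → Fin d → (idx L (cubic d (evenPeriod t)) k → ℂ)} (hV : ∀ t, LipschitzBackground L (cubic d (evenPeriod t)) (V t) α β)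
    (hV1 : ∀ (μ f : Fin d) (z : Fin d → ℤ), ∃ s : ℂ, Tendsto (fun t => V t k μ (castT (cubic d (lev L k * evenPeriod t)) z, f)) atTop (𝓝 s))
    (μ ν : Fin d) (z z' : Fin d → ℤ) :
    ∃ s : ℂ, Tendsto (fun t => (avgTow (QBlev L (cubic d (evenPeriod t))) ((L : ℝ) ^ d)
        (fun k' => ((calDalev L (cubic d (evenPeriod t)) a ha k')⁻¹ * Pmodel L (cubic d (evenPeriod t)) (V t) k') ^ 1 * (calDalev L (cubic d (evenPeriod t)) a ha k')⁻¹) k)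
      ((unitIdx L (cubic d (evenPeriod t))).symm (castT (cubic d (evenPeriod t)) z, μ)) ((unitIdx L (cubic d (evenPeriod t))).symm (castT (cubic d (evenPeriod t)) z', ν))) atTop (𝓝 s) := by
  have hα : 0 ≤ α := (hV 0).nonneg.1
  have hb0 : 0 ≤ d * (α * (2 * lev L k)) := by positivity
  obtain ⟨s, hs⟩ := tendsto_avgTow_pair_of_fine L k
    (X := fun t k' => calGlev L (cubic d (evenPeriod t)) a ha k' * Pmodel L (cubic d (evenPeriod t)) (V t) k' * calGlev L (cubic d (evenPeriod t)) a ha k')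
    (fun f g w w' => tendsto_GPG_pair L a ha hd k (P := fun t k' => Pmodel L (cubic d (evenPeriod t)) (V t) k') hb0
      (fun t w' g' y h' => norm_Pmodel_apply_le L (cubic d (evenPeriod t)) (hV t) k _ _)
      (fun f' g' u u' => tendsto_Pmodel_pair_of_tendsto L tendsto_evenPeriod k V hV1 f' g' u u') f g w w') μ ν z z'
  refine ⟨s, hs.congr fun t => ?_⟩
  rw [avgIns_eq L (cubic d (evenPeriod t)) a ha (V t)]
  simp only [Matrix.reindex_apply, Matrix.submatrix_apply]

end ChainLimits

end Summit.QuantumFields.BalabanUV.Beta.GAN24.InsertionChainVolumeLimit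

end
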